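import Summits.KontsevichZagierPeriods.KontsevichZagierPeriods.Theses.TorsionLogs
import Summits.KontsevichZagierPeriods.KontsevichZagierPeriods.Theorems.TorsionLogsNeronTorsionSector
import Summits.KontsevichZagierPeriods.KontsevichZagierPeriods.Theorems.TorsionLogsNeronTorsionSectorStubRealDictionary
import Literature.NumberTheory.Transcendental.KZKernelConjectureForms
import Literature.NumberTheory.Transcendental.KZProductIdeal

/-!
# Crux `TorsionSectorComplete` (stmt-KontsevichZagierPeriods-14212) — line `NeronTorsionDepthThree`
# (forward generator G1 `next-rung` over the floor `NeronTorsionPrimitiveChain`, unit fwd2-rung-KontsevichZagierPeriods-01, gen 11)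

Route `TorsionLogs` (route-KontsevichZagierPeriods-TorsionLogs; `closes (h₁ : NeronTorsionSector)
(h₂ : TorsionSectorComplete) : KontsevichZagierPeriods`; `h₁` CLOSED by the landed translation chain
`NeronTorsionSector_of = NeronTorsionSector_of_primitiveChain stub_assembly`, `h₂` the open residual).

FLOOR (seed g1-KontsevichZagierPeriods-17981, CLOSED): `Theses.TorsionLogs.NeronTorsionPrimitiveChain` — the
LENGTH-TWO Néron–torsion chain `q²•[rI] + p²•[rP] − c•[rB] ∈ KZ.relations` at a real `N`-torsion point `P` on the
identity component of `y² = f(x) = 4x³ − g₂x − g₃` (`rI` = the iterated triangle `e₁ < x₁ < x₀ < x_P` of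
`x₁dx₁dx₀/(√f√f)`, `rP` = the quadrant `η₁·ω₁/2`, `rB` = a log carrier).

ONE MOVE — LEVEL LIFT in the ITERATED LENGTH, ℓ : 2 → 3.  The new member is the TIED LENGTH-THREE NÉRON–TORSION
SECTOR STATEMENT `NeronTorsionDepthThreeSector`: at the same data, with

  `r3P = [e₁<z₂<z₁<z₀<x_P,  z₂/(√f(z₂)√f(z₁)√f(z₀))]`   (the floor's triangle with one more `dx/√f` on top: L₃(P)),
  `r3O = [e₁<z₂<z₁<z₀,       same]`                      (the complete length-three integral L₃(O), abs. convergent),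
  `rJp − rJm = [x_P<z₀, ΨSq_N(z₀) ≷ z₁ ≷ 1, dz₁dz₀/(z₁√f(z₀))]`  (= ∫_{x_P}^∞ log ΨSq_N(x) dx/√f, `WeierstrassCurve.ΨSq`
                                                          of `⟨0,0,0,−g₂/4,−g₃/4⟩`, the square of the N-division polynomial),
  `rEta = [(e₁,∞), (g₂t+2g₃)/(2t²√f)] = η₁`,  `rA = [(e₁,∞), 1/√f] = ω₁/2`,  `rB = [1<t<B, 1/t] = log B`,

every integer `c` with (in value)
  `12N³·r3P − 12(N³−2a)·r3O + 6N·(rJp − rJm) − 2a(4a²−6aN+3N²−1)·rEta·rA·rA − c·rA·rB = 0`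
gives `12N³•[r3P] − 12(N³−2a)•[r3O] + 6N•([rJp]−[rJm]) − 2a(4a²−6aN+3N²−1)•[rEta][rA][rA] − c•[rA][rB] ∈ KZ.relations`
(products in the product calculus `KZProduct`).  TRUE INSTANCE (elliptic Clausen function Φ(u) = ∫ log|σ|, the
multiplication formula `σ(Nu) = ψ_N(℘u)σ(u)^{N²}` integrated along the real arc, Legendre):
`c·log B = 3a(N²−1)·log|ψ₃(e₁)|`, `ψ₃(e₁) = 3e₁⁴ − (3/2)g₂e₁² − 3g₃e₁ − g₂²/16 < 0`; numerically certified on 24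
instances (3 curves incl. both signs of Δ and `g₃ = 0`, N = 3…8, a = 1…3; relative residual ≤ 1.3e-15; seat folder
`num/len3t.py`, `num/results_len3.txt`, table in the line card).

FAMILY (honest containment): `NeronTorsionLengthMember : Bool → Prop`, `false ↦` the floor decl VERBATIM, `true ↦`
`NeronTorsionDepthThreeSector`; THE RUNG `NeronTorsionLengths := ∀ three, NeronTorsionLengthMember three`.  The family
is graded by ℓ ∈ {2, 3} and nothing else varies.

SKELETON (2 registered stubs → the crux BY NAME):
* `stub_depthThreeChain : DepthThreePrimitiveChain` (XL, THE REAL STEP) — the primitive (∃-form) length-three chain: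
  some integer `c`, algebraic `B > 1` and log carrier `rB` with the element in `KZ.relations`.
* `stub_depthThreeSectorComplete : DepthThreeSectorComplete` (residual, conjecture-grade) — completeness of
  rational-shape equalities modulo `relations ⊔ closure (T ∪ T⁽³⁾)`, `T` the crux's tied set, `T⁽³⁾` the tied
  length-three set; WEAKER than the crux (`depthThreeSectorComplete_of_torsionSectorComplete`).
Proved here (no `sorry`): the tied member from the primitive chain (`depthThreeSector_of_primitiveChain`: soundness,
`ω₁ > 0` from the landed real dictionary, the landed log calculus `interval_log_relation_mem_relations`, and the
left-ideal property of `relations` in the product calculus), the rung, `closure T⁽³⁾ ≤ relations`, `closure T ≤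
relations` (the closed sibling crux `NeronTorsionSector_of`), the F4 on-path theorem, and `TorsionSectorComplete_of`.
-/

noncomputable section

open Set MeasureTheory Filter Topology
open Literature.NumberTheory.Transcendental Literature.ModelTheory.ExponentialFields
open Summit.KontsevichZagierPeriods.KontsevichZagierPeriods.Theses.TorsionLogs (NeronTorsionSector NeronTorsionPrimitiveChain
  NeronTorsionPrimitiveChain_holds TorsionSectorComplete)
open Summit.KontsevichZagierPeriods.HyperbolicBloch.OffTetraSectorKernel (interval_log_relation_mem_relations)
open Summit.KontsevichZagierPeriods.KontsevichZagierPeriods.Cruxes.NeronTorsionSector.Translation (logRep_value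
  isAlgebraic_of_logRep NeronTorsionSector_of stub_realDictionary)

-- `Summit.KontsevichZagierPeriods.KontsevichZagierPeriods.…` is the tree's mandated layout (single-conjunct summit).
set_option linter.dupNamespace false

namespace Summit.KontsevichZagierPeriods.KontsevichZagierPeriods.Cruxes.TorsionSectorComplete.NeronTorsionDepthThree

/-! ### Statements -/

/-- **Member `true` (ℓ = 3): the TIED LENGTH-THREE NÉRON–TORSION SECTOR STATEMENT.** For the floor's curve/torsion data
verbatim (real cubic `f = 4x³ − g₂x − g₃`, `g₂³ ≠ 27g₃²`, largest root `e₁ > 0`, `f > 0` beyond, `P = (x_P, y_P)` of exact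
order `N ≥ 3` on the identity component with `N∫_{x_P}^∞ dx/√f = a·ω₁`, `0 < 2a < N`) and representations pinned as
`r3P = [e₁<z₂<z₁<z₀<x_P, z₂/(√f√f√f)]`, `r3O = [e₁<z₂<z₁<z₀, same]`, `rJp = [x_P<z₀, 1<z₁<ΨSq_N(z₀), 1/(z₁√f(z₀))]`,
`rJm = [x_P<z₀, ΨSq_N(z₀)<z₁<1, same]`, `rEta = [(e₁,∞), (g₂t+2g₃)/(2t²√f)]`, `rA = [(e₁,∞), 1/√f]`, `rB = [1<t<B, 1/t]`
(`B > 1`), every integer `c` satisfying the VALUE HYPOTHESIS gives an element of `KZ.relations`.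
[cite: KontsevichZagier2001, §1.2] [cite: Lang1983, Ch. 13] [cite: SilvermanATAEC1994, VI Ex. 6.4] -/
def NeronTorsionDepthThreeSector : Prop :=
  ∀ (g₂ g₃ e₁ xP yP B : ℝ) (N a : ℕ) (c : ℤ) (f : ℝ → ℝ),
    (∀ x, f x = 4 * x ^ 3 - g₂ * x - g₃) → g₂ ^ 3 - 27 * g₃ ^ 2 ≠ 0 → f e₁ = 0 → 0 < e₁ →
    (∀ x, e₁ < x → 0 < f x) → e₁ < xP → yP ^ 2 = f xP → 3 ≤ N → 0 < a → 2 * a < N →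
    (∀ hns : (⟨0, 0, 0, -g₂ / 4, -g₃ / 4⟩ : WeierstrassCurve ℝ).toAffine.Nonsingular xP (yP / 2),
      addOrderOf (WeierstrassCurve.Affine.Point.some xP (yP / 2) hns) = N) →
    (N : ℝ) * (∫ x in Set.Ioi xP, (Real.sqrt (f x))⁻¹) = a * (2 * ∫ x in Set.Ioi e₁, (Real.sqrt (f x))⁻¹) →
    1 < B →
    ∀ (r3P r3O : KZ.IntegralRep 3) (rJp rJm : KZ.IntegralRep 2) (rEta rA rB : KZ.IntegralRep 1),
    r3P.domain = {z | e₁ < z 2 ∧ z 2 < z 1 ∧ z 1 < z 0 ∧ z 0 < xP} →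
    Set.EqOn r3P.integrand
      (fun z => z 2 / (Real.sqrt (f (z 2)) * Real.sqrt (f (z 1)) * Real.sqrt (f (z 0)))) r3P.domain →
    r3O.domain = {z | e₁ < z 2 ∧ z 2 < z 1 ∧ z 1 < z 0} →
    Set.EqOn r3O.integrand
      (fun z => z 2 / (Real.sqrt (f (z 2)) * Real.sqrt (f (z 1)) * Real.sqrt (f (z 0)))) r3O.domain →
    rJp.domain = {z | xP < z 0 ∧ 1 < z 1 ∧
      z 1 < ((⟨0, 0, 0, -g₂ / 4, -g₃ / 4⟩ : WeierstrassCurve ℝ).ΨSq N).eval (z 0)} →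
    Set.EqOn rJp.integrand (fun z => (z 1)⁻¹ * (Real.sqrt (f (z 0)))⁻¹) rJp.domain →
    rJm.domain = {z | xP < z 0 ∧
      ((⟨0, 0, 0, -g₂ / 4, -g₃ / 4⟩ : WeierstrassCurve ℝ).ΨSq N).eval (z 0) < z 1 ∧ z 1 < 1} →
    Set.EqOn rJm.integrand (fun z => (z 1)⁻¹ * (Real.sqrt (f (z 0)))⁻¹) rJm.domain →
    rEta.domain = {t | e₁ < t 0} →
    Set.EqOn rEta.integrand (fun t => (g₂ * t 0 + 2 * g₃) / (2 * (t 0) ^ 2 * Real.sqrt (f (t 0)))) rEta.domain →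
    rA.domain = {t | e₁ < t 0} → Set.EqOn rA.integrand (fun t => (Real.sqrt (f (t 0)))⁻¹) rA.domain →
    rB.domain = {t | 1 < t 0 ∧ t 0 < B} → Set.EqOn rB.integrand (fun t => (t 0)⁻¹) rB.domain →
    12 * (N : ℝ) ^ 3 * r3P.value - 12 * ((N : ℝ) ^ 3 - 2 * a) * r3O.value
      + 6 * (N : ℝ) * (rJp.value - rJm.value)
      - 2 * a * (4 * (a : ℝ) ^ 2 - 6 * a * N + 3 * (N : ℝ) ^ 2 - 1) * (rEta.value * rA.value * rA.value)
      - c * (rA.value * rB.value) = 0 →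
    (12 * (N : ℤ) ^ 3) • KZ.of r3P - (12 * ((N : ℤ) ^ 3 - 2 * a)) • KZ.of r3O
      + (6 * (N : ℤ)) • (KZ.of rJp - KZ.of rJm)
      - (2 * (a : ℤ) * (4 * (a : ℤ) ^ 2 - 6 * a * N + 3 * (N : ℤ) ^ 2 - 1)) • (KZ.of rEta * KZ.of rA * KZ.of rA)
      - c • (KZ.of rA * KZ.of rB) ∈ KZ.relations

/-- **The family, graded by the iterated length (`false` ↦ ℓ = 2, `true` ↦ ℓ = 3).** Member `false` is the floor decl
`Theses.TorsionLogs.NeronTorsionPrimitiveChain` VERBATIM (the seed, CLOSED); member `true` is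
`NeronTorsionDepthThreeSector`. Honest containment: the family is indexed by ℓ ∈ {2, 3}, nothing else varies. -/
def NeronTorsionLengthMember : Bool → Prop
  | false => NeronTorsionPrimitiveChain
  | true => NeronTorsionDepthThreeSector

/-- **THE RUNG `NeronTorsionLengths`: both lengths.** `∀ three, NeronTorsionLengthMember three` — the proved floor
(ℓ = 2) and the new length-three sector statement (ℓ = 3). -/
def NeronTorsionLengths : Prop := ∀ three : Bool, NeronTorsionLengthMember three

/-- **Stub A statement (XL, THE REAL STEP): the PRIMITIVE LENGTH-THREE NÉRON–TORSION CHAIN.**  Same data and pinned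
representations as the tied member, no `B`/`rB`/`c`/value hypothesis: there EXIST an integer `c`, an algebraic `B > 1`
and a log carrier `rB = [1<t<B, 1/t]` with the length-three element in `KZ.relations`.  Plan ([N]-route): the
parametric depth-two distribution relation `N²·I(w) = Ĩ(Nw) + log|ψ_N(℘w)| + (N²−1)κ + (η₁/2)N(N−1)w` (the floor's
identity with the torsion point replaced by a moving point — `σ(Nu) = ψ_N σ^{N²}`) integrated in `w` over `(0, u_P)`
against `du = dx/√f`, the outer substitution `v = Nw` unfolded over the `2a` half-period sheets it crosses
(`∫₀^{aω₁} Ĩ = 2a·L₃(O) + η₁ω₁²·(polynomial in a)`), every step a Stokes / change-of-variables move on `ℚ`-semialgebraic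
cells; the constant `(N²−1)κ·u_P`-terms collapse to `3a(N²−1)·(ω₁/2)·log|ψ₃(e₁)|` by the floor at `N = 3`-type
normalisation of `κ`.  Alternative (translation-route = the floor's machine one level up): translate the triangle by
`P` fibrewise; the kernel polynomial `∏ₖ(x − x(kP))` of the cyclic `N`-isogeny appears in place of `ΨSq_N`.
[cite: KontsevichZagier2001, §1.2] [cite: Lang1983, Ch. 13 Thm 1.1] [cite: SilvermanATAEC1994, VI Ex. 6.4] -/
def DepthThreePrimitiveChain : Prop :=
  ∀ (g₂ g₃ e₁ xP yP : ℝ) (N a : ℕ) (f : ℝ → ℝ),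
    (∀ x, f x = 4 * x ^ 3 - g₂ * x - g₃) → g₂ ^ 3 - 27 * g₃ ^ 2 ≠ 0 → f e₁ = 0 → 0 < e₁ →
    (∀ x, e₁ < x → 0 < f x) → e₁ < xP → yP ^ 2 = f xP → 3 ≤ N → 0 < a → 2 * a < N →
    (∀ hns : (⟨0, 0, 0, -g₂ / 4, -g₃ / 4⟩ : WeierstrassCurve ℝ).toAffine.Nonsingular xP (yP / 2),
      addOrderOf (WeierstrassCurve.Affine.Point.some xP (yP / 2) hns) = N) →
    (N : ℝ) * (∫ x in Set.Ioi xP, (Real.sqrt (f x))⁻¹) = a * (2 * ∫ x in Set.Ioi e₁, (Real.sqrt (f x))⁻¹) →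
    ∀ (r3P r3O : KZ.IntegralRep 3) (rJp rJm : KZ.IntegralRep 2) (rEta rA : KZ.IntegralRep 1),
    r3P.domain = {z | e₁ < z 2 ∧ z 2 < z 1 ∧ z 1 < z 0 ∧ z 0 < xP} →
    Set.EqOn r3P.integrand
      (fun z => z 2 / (Real.sqrt (f (z 2)) * Real.sqrt (f (z 1)) * Real.sqrt (f (z 0)))) r3P.domain →
    r3O.domain = {z | e₁ < z 2 ∧ z 2 < z 1 ∧ z 1 < z 0} →
    Set.EqOn r3O.integrand
      (fun z => z 2 / (Real.sqrt (f (z 2)) * Real.sqrt (f (z 1)) * Real.sqrt (f (z 0)))) r3O.domain →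
    rJp.domain = {z | xP < z 0 ∧ 1 < z 1 ∧
      z 1 < ((⟨0, 0, 0, -g₂ / 4, -g₃ / 4⟩ : WeierstrassCurve ℝ).ΨSq N).eval (z 0)} →
    Set.EqOn rJp.integrand (fun z => (z 1)⁻¹ * (Real.sqrt (f (z 0)))⁻¹) rJp.domain →
    rJm.domain = {z | xP < z 0 ∧
      ((⟨0, 0, 0, -g₂ / 4, -g₃ / 4⟩ : WeierstrassCurve ℝ).ΨSq N).eval (z 0) < z 1 ∧ z 1 < 1} →
    Set.EqOn rJm.integrand (fun z => (z 1)⁻¹ * (Real.sqrt (f (z 0)))⁻¹) rJm.domain →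
    rEta.domain = {t | e₁ < t 0} →
    Set.EqOn rEta.integrand (fun t => (g₂ * t 0 + 2 * g₃) / (2 * (t 0) ^ 2 * Real.sqrt (f (t 0)))) rEta.domain →
    rA.domain = {t | e₁ < t 0} → Set.EqOn rA.integrand (fun t => (Real.sqrt (f (t 0)))⁻¹) rA.domain →
    ∃ (c : ℤ) (B : ℝ) (rB : KZ.IntegralRep 1), 1 < B ∧ IsAlgebraic ℚ B ∧
      rB.domain = {t | 1 < t 0 ∧ t 0 < B} ∧ Set.EqOn rB.integrand (fun t => (t 0)⁻¹) rB.domain ∧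
      (12 * (N : ℤ) ^ 3) • KZ.of r3P - (12 * ((N : ℤ) ^ 3 - 2 * a)) • KZ.of r3O
        + (6 * (N : ℤ)) • (KZ.of rJp - KZ.of rJm)
        - (2 * (a : ℤ) * (4 * (a : ℤ) ^ 2 - 6 * a * N + 3 * (N : ℤ) ^ 2 - 1)) • (KZ.of rEta * KZ.of rA * KZ.of rA)
        - c • (KZ.of rA * KZ.of rB) ∈ KZ.relations

/-- The identity-component tied set `T` of the crux `TorsionSectorComplete` (copied verbatim). -/
def TorsionTied : Set Literature.NumberTheory.Transcendental.KZ.FormalRep := {d : Literature.NumberTheory.Transcendental.KZ.FormalRep | ∃ (g₂ g₃ e₁ xP yP α : ℝ) (N a : ℕ) (M k m : ℤ) (f : ℝ → ℝ) (rI rP : Literature.NumberTheory.Transcendental.KZ.IntegralRep 2) (rL : Literature.NumberTheory.Transcendental.KZ.IntegralRep 1), (∀ x, f x = 4 * x ^ 3 - g₂ * x - g₃) ∧ g₂ ^ 3 - 27 * g₃ ^ 2 ≠ 0 ∧ f e₁ = 0 ∧ 0 < e₁ ∧ (∀ x, e₁ < x → 0 < f x) ∧ e₁ < xP ∧ yP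 ^ 2 = f xP ∧ 3 ≤ N ∧ 0 < a ∧ 2 * a < N ∧ 4 * (N : ℤ) ^ 2 * k = M * ((N : ℤ) - 2 * (a : ℤ)) ^ 2 ∧ (∀ hns : (⟨0, 0, 0, -g₂ / 4, -g₃ / 4⟩ : WeierstrassCurve ℝ).toAffine.Nonsingular xP (yP / 2), addOrderOf (WeierstrassCurve.Affine.Point.some xP (yP / 2) hns) = N) ∧ (N : ℝ) * (∫ x in Set.Ioi xP, (Real.sqrt (f x))⁻¹) = a * (2 * ∫ x in Set.Ioi e₁, (Real.sqrt (f x))⁻¹) ∧ 1 < α ∧ rI.domain = {z | e₁ < z 1 ∧ z 1 < z 0 ∧ z 0 < xP} ∧ Set.EqOn rI.integrand (fun z => z 1 / (Real.sqrt (f (z 1)) * Real.sqrt (f (z 0)))) rI.domain ∧ rP.domain = {z | e₁ < z 0 ∧ e₁ < z 1} ∧ Set.EqOn rP.integrand (fun z => (Real.sqrt (f (z 0)))⁻¹ * ((g₂ * z 1 + 2 * g₃) / (2 * (z 1) ^ 2 * Real.sqrt (f (z 1))))) rP.domain ∧ rL.domain = {t | 1 < t 0 ∧ t 0 < α} ∧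 Set.EqOn rL.integrand (fun t => (t 0)⁻¹) rL.domain ∧ (M : ℝ) * rI.value + k * rP.value = m * rL.value ∧ d = M • Literature.NumberTheory.Transcendental.KZ.of rI + k • Literature.NumberTheory.Transcendental.KZ.of rP - m • Literature.NumberTheory.Transcendental.KZ.of rL}


/-- The tied LENGTH-THREE set `T⁽³⁾`: the elements of the member `true`, with their value hypothesis. -/
def DepthThreeTied : Set Literature.NumberTheory.Transcendental.KZ.FormalRep :=
  {d | ∃ (g₂ g₃ e₁ xP yP B : ℝ) (N a : ℕ) (c : ℤ) (f : ℝ → ℝ) (r3P r3O : KZ.IntegralRep 3)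
      (rJp rJm : KZ.IntegralRep 2) (rEta rA rB : KZ.IntegralRep 1),
    (∀ x, f x = 4 * x ^ 3 - g₂ * x - g₃) ∧ g₂ ^ 3 - 27 * g₃ ^ 2 ≠ 0 ∧ f e₁ = 0 ∧ 0 < e₁ ∧
    (∀ x, e₁ < x → 0 < f x) ∧ e₁ < xP ∧ yP ^ 2 = f xP ∧ 3 ≤ N ∧ 0 < a ∧ 2 * a < N ∧
    (∀ hns : (⟨0, 0, 0, -g₂ / 4, -g₃ / 4⟩ : WeierstrassCurve ℝ).toAffine.Nonsingular xP (yP / 2),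
      addOrderOf (WeierstrassCurve.Affine.Point.some xP (yP / 2) hns) = N) ∧
    (N : ℝ) * (∫ x in Set.Ioi xP, (Real.sqrt (f x))⁻¹) = a * (2 * ∫ x in Set.Ioi e₁, (Real.sqrt (f x))⁻¹) ∧
    1 < B ∧
    r3P.domain = {z | e₁ < z 2 ∧ z 2 < z 1 ∧ z 1 < z 0 ∧ z 0 < xP} ∧
    Set.EqOn r3P.integrand
      (fun z => z 2 / (Real.sqrt (f (z 2)) * Real.sqrt (f (z 1)) * Real.sqrt (f (z 0)))) r3P.domain ∧
    r3O.domain = {z | e₁ < z 2 ∧ z 2 < z 1 ∧ z 1 < z 0} ∧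
    Set.EqOn r3O.integrand
      (fun z => z 2 / (Real.sqrt (f (z 2)) * Real.sqrt (f (z 1)) * Real.sqrt (f (z 0)))) r3O.domain ∧
    rJp.domain = {z | xP < z 0 ∧ 1 < z 1 ∧
      z 1 < ((⟨0, 0, 0, -g₂ / 4, -g₃ / 4⟩ : WeierstrassCurve ℝ).ΨSq N).eval (z 0)} ∧
    Set.EqOn rJp.integrand (fun z => (z 1)⁻¹ * (Real.sqrt (f (z 0)))⁻¹) rJp.domain ∧
    rJm.domain = {z | xP < z 0 ∧
      ((⟨0, 0, 0, -g₂ / 4, -g₃ / 4⟩ : WeierstrassCurve ℝ).ΨSq N).eval (z 0) < z 1 ∧ z 1 < 1} ∧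
    Set.EqOn rJm.integrand (fun z => (z 1)⁻¹ * (Real.sqrt (f (z 0)))⁻¹) rJm.domain ∧
    rEta.domain = {t | e₁ < t 0} ∧
    Set.EqOn rEta.integrand (fun t => (g₂ * t 0 + 2 * g₃) / (2 * (t 0) ^ 2 * Real.sqrt (f (t 0)))) rEta.domain ∧
    rA.domain = {t | e₁ < t 0} ∧ Set.EqOn rA.integrand (fun t => (Real.sqrt (f (t 0)))⁻¹) rA.domain ∧
    rB.domain = {t | 1 < t 0 ∧ t 0 < B} ∧ Set.EqOn rB.integrand (fun t => (t 0)⁻¹) rB.domain ∧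
    12 * (N : ℝ) ^ 3 * r3P.value - 12 * ((N : ℝ) ^ 3 - 2 * a) * r3O.value
      + 6 * (N : ℝ) * (rJp.value - rJm.value)
      - 2 * a * (4 * (a : ℝ) ^ 2 - 6 * a * N + 3 * (N : ℝ) ^ 2 - 1) * (rEta.value * rA.value * rA.value)
      - c * (rA.value * rB.value) = 0 ∧
    d = (12 * (N : ℤ) ^ 3) • KZ.of r3P - (12 * ((N : ℤ) ^ 3 - 2 * a)) • KZ.of r3O
      + (6 * (N : ℤ)) • (KZ.of rJp - KZ.of rJm)
      - (2 * (a : ℤ) * (4 * (a : ℤ) ^ 2 - 6 * a * N + 3 * (N : ℤ) ^ 2 - 1)) • (KZ.of rEta * KZ.of rA * KZ.of rA)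
      - c • (KZ.of rA * KZ.of rB)}

/-- **Stub D statement (residual, conjecture-grade): completeness off the sector enlarged by the length-three
elements.**  Two rational-shape representations with equal values differ by an element of
`relations ⊔ closure (T ∪ T⁽³⁾)`.  Between `KZKernelConjecture` (`relations` alone) and the crux (`relations ⊔ closure T`);
WEAKER than the crux (`depthThreeSectorComplete_of_torsionSectorComplete`). [cite: KontsevichZagier2001, §1.2 Conjecture 1] -/
def DepthThreeSectorComplete : Prop := ∀ ⦃n m : ℕ⦄ (r : Literature.NumberTheory.Transcendental.KZ.IntegralRep n) (r' : Literature.NumberTheory.Transcendental.KZ.IntegralRep m), r.IsRational → r'.IsRational → r.value = r'.value → Literature.NumberTheory.Transcendental.KZ.of r - Literature.NumberTheory.Transcendental.KZ.of r' ∈ Literature.NumberTheory.Transcendental.KZ.relations ⊔ AddSubgroup.closure (TorsionTied ∪ DepthThreeTied)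

/-! ### Registered stubs -/

/-- **Stub A (XL, load-bearing, the new move).** `DepthThreePrimitiveChain`. -/
theorem stub_depthThreeChain : DepthThreePrimitiveChain := by
  sorry

/-- **Stub D (residual, conjecture-grade).** `DepthThreeSectorComplete`. -/
theorem stub_depthThreeSectorComplete : DepthThreeSectorComplete := by
  sorry

/-! ### Proved infrastructure (no `sorry` below this line) -/

/-- The crux unfolds to completeness relative to `relations ⊔ closure T`. -/
theorem torsionSectorComplete_iff :
    TorsionSectorComplete ↔ ∀ ⦃n m : ℕ⦄ (r : Literature.NumberTheory.Transcendental.KZ.IntegralRep n) (r' : Literature.NumberTheory.Transcendental.KZ.IntegralRep m), r.IsRational → r'.IsRational → r.value = r'.value → Literature.NumberTheory.Transcendental.KZ.of r - Literature.NumberTheory.Transcendental.KZ.of r' ∈ Literature.NumberTheory.Transcendental.KZ.relations ⊔ AddSubgroup.closure TorsionTied :=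
  Iff.rfl

/-- Member `false` is the floor, definitionally. -/
theorem member_false_iff : NeronTorsionLengthMember false ↔ NeronTorsionPrimitiveChain := Iff.rfl

/-- Member `true` is the length-three statement, definitionally. -/
theorem member_true_iff : NeronTorsionLengthMember true ↔ NeronTorsionDepthThreeSector := Iff.rfl

/-- The rung is the floor plus the new member. -/
theorem neronTorsionLengths_iff : NeronTorsionLengths ↔ NeronTorsionPrimitiveChain ∧ NeronTorsionDepthThreeSector := by
  constructor
  · exact fun h => ⟨h false, h true⟩
  · rintro ⟨h₂, h₃⟩ (_ | _)
    · exact h₂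
    · exact h₃

/-- **F3 WITNESS: the rung at the floor.** Member `false` is the CLOSED seed `NeronTorsionPrimitiveChain`
(`Cruxes.NeronTorsionSector.Translation.stub_assembly`, landed; route link `NeronTorsionPrimitiveChain_holds`). -/
theorem rung_false : NeronTorsionLengthMember false := NeronTorsionPrimitiveChain_holds

/-- Transfer of the pinned one-dimensional representation `rA = [(e₁,∞), 1/√f]` to the real half-line integral
(`MeasurableEquiv.funUnique`, `volume_preserving_funUnique`). [folklore] -/
theorem value_rA {e₁ : ℝ} {f : ℝ → ℝ} (rA : KZ.IntegralRep 1) (hdA : rA.domain = {t | e₁ < t 0})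
    (hiA : Set.EqOn rA.integrand (fun t => (Real.sqrt (f (t 0)))⁻¹) rA.domain) :
    rA.value = ∫ x in Set.Ioi e₁, (Real.sqrt (f x))⁻¹ := by
  rw [KZ.IntegralRep.value]
  have hmeas : MeasurableSet rA.domain := by
    rw [hdA]
    exact measurableSet_lt measurable_const (measurable_pi_apply 0)
  rw [setIntegral_congr_fun hmeas hiA, hdA]
  have hpre : {t : Fin 1 → ℝ | e₁ < t 0} = MeasurableEquiv.funUnique (Fin 1) ℝ ⁻¹' Set.Ioi e₁ := by
    ext x
    simp [MeasurableEquiv.funUnique, Fin.default_eq_zero]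
  rw [hpre]
  exact (volume_preserving_funUnique (Fin 1) ℝ).setIntegral_preimage_emb
    (MeasurableEquiv.funUnique (Fin 1) ℝ).measurableEmbedding (fun x => (Real.sqrt (f x))⁻¹) (Set.Ioi e₁)

/-- **Bookkeeping: the primitive length-three chain gives the tied member.**  Soundness of `relations` for the chain's
value, `ω₁/2 = rA.value > 0` (landed real dictionary), so the value hypothesis forces `c₀·log B₀ = c·log B`; the
landed log calculus gives `c₀•[rB₀] − c•[rB] ∈ relations`, the left-ideal property of `relations` in the product
calculus multiplies it by `[rA]`. [cite: KontsevichZagier2001, §1.2] [cite: Lang1983, Ch. 13 Thm 1.1] -/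
theorem depthThreeSector_of_primitiveChain (hPC : DepthThreePrimitiveChain) : NeronTorsionDepthThreeSector := by
  intro g₂ g₃ e₁ xP yP B N a c f hf hdisc he he0 hpos hx hy hN ha ha2 htor hρ hB r3P r3O rJp rJm rEta rA rB
    hd3P hi3P hd3O hi3O hdJp hiJp hdJm hiJm hdEta hiEta hdA hiA hdB hiB hval
  -- the primitive chain and its value
  obtain ⟨c₀, B₀, rB₀, hB₀, hB₀alg, hdB₀, hiB₀, hprim⟩ :=
    hPC g₂ g₃ e₁ xP yP N a f hf hdisc he he0 hpos hx hy hN ha ha2 htor hρ r3P r3O rJp rJm rEta rA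
      hd3P hi3P hd3O hi3O hdJp hiJp hdJm hiJm hdEta hiEta hdA hiA
  have hvB₀ : rB₀.value = Real.log B₀ := logRep_value hB₀.le rB₀ hdB₀ hiB₀
  have hvB : rB.value = Real.log B := logRep_value hB.le rB hdB hiB
  have hBalg : IsAlgebraic ℚ B := isAlgebraic_of_logRep hB rB hdB
  have h0 : 12 * (N : ℝ) ^ 3 * r3P.value - 12 * ((N : ℝ) ^ 3 - 2 * a) * r3O.value
      + 6 * (N : ℝ) * (rJp.value - rJm.value)
      - 2 * a * (4 * (a : ℝ) ^ 2 - 6 * a * N + 3 * (N : ℝ) ^ 2 - 1) * (rEta.value * rA.value * rA.value)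
      - c₀ * (rA.value * Real.log B₀) = 0 := by
    have h := KZ.relations_le_ker_eval_holds hprim
    rw [AddMonoidHom.mem_ker] at h
    simp only [map_add, map_sub, map_zsmul, KZ.eval_of, KZ.eval_mul', zsmul_eq_mul, hvB₀] at h
    push_cast at h
    linear_combination h
  -- `rA.value = ω₁/2 > 0`
  have hApos : 0 < rA.value := by
    obtain ⟨ω, X, Y, hω, hωint, -⟩ := stub_realDictionary g₂ g₃ e₁ f hf hdisc he hpos
    rw [value_rA rA hdA hiA]
    linarith
  -- the value hypothesis becomes a relation between two logarithms of algebraic numbers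
  have hlog : (c₀ : ℝ) * Real.log B₀ - c * Real.log B = 0 := by
    rw [hvB] at hval
    have hprod : ((c₀ : ℝ) * Real.log B₀ - c * Real.log B) * rA.value = 0 := by
      linear_combination hval - h0
    rcases mul_eq_zero.mp hprod with h | h
    · exact h
    · exact absurd h hApos.ne'
  -- landed log calculus: `c₀•[rB₀] − c•[rB] ∈ relations`
  have hiB01 : Set.EqOn rB₀.integrand (fun t : Fin 1 → ℝ => 1 / t 0) rB₀.domain := fun t ht => by
    simp only [hiB₀ ht, one_div]
  have hiB1 : Set.EqOn rB.integrand (fun t : Fin 1 → ℝ => 1 / t 0) rB.domain := fun t ht => by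
    simp only [hiB ht, one_div]
  have hL : c₀ • KZ.of rB₀ - c • KZ.of rB ∈ KZ.relations := by
    have h := interval_log_relation_mem_relations 2 ![1, 1] ![B₀, B] ![c₀, -c] ![rB₀, rB]
      (fun i => by fin_cases i <;> simp)
      (fun i => by fin_cases i <;> simp [hB₀.le, hB.le])
      (fun i => by fin_cases i <;> exact isAlgebraic_one)
      (fun i => by fin_cases i <;> simp [hB₀alg, hBalg])
      (fun i => by
        fin_cases i
        · exact ⟨hdB₀, hiB01⟩
        · exact ⟨hdB, hiB1⟩)
      (by
        simp only [Fin.sum_univ_two, Matrix.cons_val_zero, Matrix.cons_val_one, div_one, Int.cast_neg]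
        linear_combination hlog)
    have e : ∑ i : Fin 2, (![c₀, -c] i : ℤ) • KZ.of (![rB₀, rB] i) = c₀ • KZ.of rB₀ - c • KZ.of rB := by
      simp only [Fin.sum_univ_two, Matrix.cons_val_zero, Matrix.cons_val_one, neg_smul]
      abel
    rw [e] at h
    exact h
  -- left-ideal property of `relations` in the product calculus
  have hAL : KZ.of rA * (c₀ • KZ.of rB₀ - c • KZ.of rB) ∈ KZ.relations := KZ.of_mul_mem_relations rA hL
  have hmul : KZ.of rA * (c₀ • KZ.of rB₀ - c • KZ.of rB) =
      c₀ • (KZ.of rA * KZ.of rB₀) - c • (KZ.of rA * KZ.of rB) := by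
    rw [mul_sub, mul_smul_comm, mul_smul_comm]
  rw [hmul] at hAL
  -- assembly
  have e : (12 * (N : ℤ) ^ 3) • KZ.of r3P - (12 * ((N : ℤ) ^ 3 - 2 * a)) • KZ.of r3O
      + (6 * (N : ℤ)) • (KZ.of rJp - KZ.of rJm)
      - (2 * (a : ℤ) * (4 * (a : ℤ) ^ 2 - 6 * a * N + 3 * (N : ℤ) ^ 2 - 1)) • (KZ.of rEta * KZ.of rA * KZ.of rA)
      - c • (KZ.of rA * KZ.of rB) =
    ((12 * (N : ℤ) ^ 3) • KZ.of r3P - (12 * ((N : ℤ) ^ 3 - 2 * a)) • KZ.of r3O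
      + (6 * (N : ℤ)) • (KZ.of rJp - KZ.of rJm)
      - (2 * (a : ℤ) * (4 * (a : ℤ) ^ 2 - 6 * a * N + 3 * (N : ℤ) ^ 2 - 1)) • (KZ.of rEta * KZ.of rA * KZ.of rA)
      - c₀ • (KZ.of rA * KZ.of rB₀)) + (c₀ • (KZ.of rA * KZ.of rB₀) - c • (KZ.of rA * KZ.of rB)) := by
    abel
  rw [e]
  exact KZ.relations.add_mem hprim hAL

/-- The rung from stub A (the floor is a theorem). -/
theorem neronTorsionLengths_of (hA : DepthThreePrimitiveChain) : NeronTorsionLengths :=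
  neronTorsionLengths_iff.mpr ⟨NeronTorsionPrimitiveChain_holds, depthThreeSector_of_primitiveChain hA⟩

/-- The length-three member says exactly `closure T⁽³⁾ ≤ KZ.relations`. [cite: KontsevichZagier2001, §1.2] -/
theorem closure_depthThreeTied_le_relations (h : NeronTorsionDepthThreeSector) :
    AddSubgroup.closure DepthThreeTied ≤ Literature.NumberTheory.Transcendental.KZ.relations := by
  refine (AddSubgroup.closure_le _).mpr ?_
  rintro d ⟨g₂, g₃, e₁, xP, yP, B, N, a, c, f, r3P, r3O, rJp, rJm, rEta, rA, rB, hf, hdisc, he, he0, hpos, hx, hy,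
    hN, ha, ha', hord, htor, hB, hd3P, hi3P, hd3O, hi3O, hdJp, hiJp, hdJm, hiJm, hdEta, hiEta, hdA, hiA, hdB, hiB,
    hval, rfl⟩
  exact h g₂ g₃ e₁ xP yP B N a c f hf hdisc he he0 hpos hx hy hN ha ha' hord htor hB r3P r3O rJp rJm rEta rA rB
    hd3P hi3P hd3O hi3O hdJp hiJp hdJm hiJm hdEta hiEta hdA hiA hdB hiB hval

/-- The identity-component sector (the route's CLOSED sibling crux `NeronTorsionSector`, landed as
`NeronTorsionSector_of`) says exactly `closure T ≤ KZ.relations`. [cite: KontsevichZagier2001, §1.2] -/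
theorem closure_torsionTied_le_relations :
    AddSubgroup.closure TorsionTied ≤ Literature.NumberTheory.Transcendental.KZ.relations := by
  have h : NeronTorsionSector := NeronTorsionSector_of
  refine (AddSubgroup.closure_le _).mpr ?_
  rintro d ⟨g₂, g₃, e₁, xP, yP, α, N, a, M, k, m', f, rI, rP, rL, hf, hdisc, he, he0, hpos, hx, hy, hN, ha,
    ha', htie, hord, htor, hα, hdI, hiI, hdP, hiP, hdL, hiL, hval, rfl⟩
  exact h g₂ g₃ e₁ xP yP α N a M k m' f hf hdisc he he0 hpos hx hy hN ha ha' htie hord htor hα rI rP rL hdI hiI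
    hdP hiP hdL hiL hval

/-- **F4 ON-PATH, new member:** Conjecture 1 (kernel form, `kzKernelConjecture_iff_isRational`) gives the tied
length-three statement — the element evaluates (by `KZ.eval_mul'`) to the value hypothesis.  Tagged `@[simp]` so that
the tribunal's forward probe `S → Rung` closes. [cite: KontsevichZagier2001, §1.2] -/
@[simp] theorem depthThreeSector_of_kontsevichZagierPeriods (h : _root_.KontsevichZagierPeriods) :
    NeronTorsionDepthThreeSector := by
  have hK : KZKernelConjecture := kzKernelConjecture_iff_isRational.mpr h
  intro g₂ g₃ e₁ xP yP B N a c f _ _ _ _ _ _ _ _ _ _ _ _ _ r3P r3O rJp rJm rEta rA rB _ _ _ _ _ _ _ _ _ _ _ _ _ _ hval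
  apply hK
  simp only [map_sub, map_add, map_zsmul, KZ.eval_mul', KZ.eval_of, zsmul_eq_mul]
  push_cast
  linear_combination hval

/-- **F4 ON-PATH LEMMA: the summit implies the rung** (member `false` is a theorem outright). -/
@[simp] theorem neronTorsionLengths_of_kontsevichZagierPeriods (h : _root_.KontsevichZagierPeriods) :
    NeronTorsionLengths :=
  neronTorsionLengths_iff.mpr ⟨NeronTorsionPrimitiveChain_holds, depthThreeSector_of_kontsevichZagierPeriods h⟩

/-- The same, as an implication (the literal shape `S → Rung` of the forward probe). -/
theorem onPath : _root_.KontsevichZagierPeriods → NeronTorsionLengths :=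
  neronTorsionLengths_of_kontsevichZagierPeriods

/-- The residual is a consequence of the crux (hence of the summit): `closure T ≤ closure (T ∪ T⁽³⁾)`.
(Informational: stub D is WEAKER than the crux as typed.) [folklore] -/
theorem depthThreeSectorComplete_of_torsionSectorComplete (h : TorsionSectorComplete) :
    DepthThreeSectorComplete := by
  intro n m r r' hr hr' hv
  have hmono : Literature.NumberTheory.Transcendental.KZ.relations ⊔ AddSubgroup.closure TorsionTied ≤
      Literature.NumberTheory.Transcendental.KZ.relations ⊔ AddSubgroup.closure (TorsionTied ∪ DepthThreeTied) :=
    sup_le_sup_left (AddSubgroup.closure_mono Set.subset_union_left) _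
  exact hmono (torsionSectorComplete_iff.mp h r r' hr hr' hv)

/-! ### Composition: the crux BY NAME from the two stubs -/

/-- **`TorsionSectorComplete` from the stubs** (closed term; `sorry` only through `stub_depthThreeChain` and
`stub_depthThreeSectorComplete`): the rung (stub A) folds the length-three sector into the moves
(`closure T⁽³⁾ ≤ relations`), so the residual's `relations ⊔ closure (T ∪ T⁽³⁾)` is `≤ relations ⊔ closure T`.
[cite: KontsevichZagier2001, §1.2] -/
theorem TorsionSectorComplete_of : TorsionSectorComplete := by
  suffices key : DepthThreePrimitiveChain → DepthThreeSectorComplete → TorsionSectorComplete from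
    key stub_depthThreeChain stub_depthThreeSectorComplete
  intro hA hD
  rw [torsionSectorComplete_iff]
  intro n m r r' hr hr' hv
  have hR : NeronTorsionDepthThreeSector := depthThreeSector_of_primitiveChain hA
  have hle : Literature.NumberTheory.Transcendental.KZ.relations ⊔ AddSubgroup.closure (TorsionTied ∪ DepthThreeTied) ≤
      Literature.NumberTheory.Transcendental.KZ.relations ⊔ AddSubgroup.closure TorsionTied := by
    refine sup_le le_sup_left ((AddSubgroup.closure_le _).mpr ?_)
    rintro d (hd | hd)
    · exact AddSubgroup.mem_sup_right (AddSubgroup.subset_closure hd)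
    · exact AddSubgroup.mem_sup_left (closure_depthThreeTied_le_relations hR (AddSubgroup.subset_closure hd))
  exact hle (hD r r' hr hr' hv)

end Summit.KontsevichZagierPeriods.KontsevichZagierPeriods.Cruxes.TorsionSectorComplete.NeronTorsionDepthThree

end
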